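import Summits.Ventures.HodgeRepro2.T5U11Unimodular
import Mathlib.NumberTheory.Padics.ProperSpace

/-!
# `GL₂(F)` is unimodular

For a locally compact Hausdorff field `F` with an element `a ≠ 0`, `a² ≠ 1` (every field of
characteristic zero), the modular character of `GL₂(F)` is trivial: `Δ = 1` on the centre
(`T5U11Unimodular.modularCharacterFun_eq_one_of_mem_center`) and on the image of the perfect group
`SL₂(F)` (`T5SL2Perfect`), and every `g ∈ GL₂(F)` has `g² = (det g · 1) · h` with `det h = 1`, so
`Δ(g)² = 1` and `Δ(g) = 1` (`ℝ≥0` has no `2`-torsion).  Instantiations: `GL₂(ℝ)`, `GL₂(ℂ)`, and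
`GL₂(ℚ_p)` — the support map's «a reductive `p`-adic group is unimodular» (B1) for the reductive
group `GL₂`.

Blind lane: Mathlib + own prefix only; no sorry; axioms ⊆ {propext, Classical.choice, Quot.sound}.
-/

namespace Summit.Ventures.HodgeRepro2.T5GL2Unimodular

open MeasureTheory MeasureTheory.Measure Topology Matrix
open scoped NNReal

section algebra

variable {F : Type*} [Field F]

/-- The scalar matrix `a · 1` as an element of `GL₂(F)` (`a ≠ 0`). -/
def scalar (a : F) (ha : a ≠ 0) : GL (Fin 2) F :=
  ⟨a • 1, a⁻¹ • 1, by rw [smul_mul_smul_comm, Matrix.one_mul, mul_inv_cancel₀ ha, one_smul],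
    by rw [smul_mul_smul_comm, Matrix.one_mul, inv_mul_cancel₀ ha, one_smul]⟩

/-- The matrix of `scalar a`. -/
@[simp] lemma coe_scalar (a : F) (ha : a ≠ 0) :
    ((scalar a ha : GL (Fin 2) F) : Matrix (Fin 2) (Fin 2) F) = a • 1 :=
  rfl

/-- The matrix of `(scalar a)⁻¹`. -/
@[simp] lemma coe_scalar_inv (a : F) (ha : a ≠ 0) :
    (((scalar a ha)⁻¹ : GL (Fin 2) F) : Matrix (Fin 2) (Fin 2) F) = a⁻¹ • 1 :=
  rfl

/-- Scalar matrices are central in `GL₂(F)`. -/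
theorem scalar_mem_center (a : F) (ha : a ≠ 0) : scalar a ha ∈ Subgroup.center (GL (Fin 2) F) := by
  rw [Subgroup.mem_center_iff]
  intro g
  apply Units.ext
  rw [Units.val_mul, Units.val_mul, coe_scalar, mul_smul_comm, smul_mul_assoc, Matrix.mul_one,
    Matrix.one_mul]

/-- The image of `SL₂(F)` in `GL₂(F)` lies in the commutator subgroup (`SL₂(F)` is perfect). -/
theorem toGL_mem_commutator (a : F) (ha : a ≠ 0) (ha2 : a ^ 2 ≠ 1)
    (h : SpecialLinearGroup (Fin 2) F) : SpecialLinearGroup.toGL h ∈ commutator (GL (Fin 2) F) := by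
  have hmap : SpecialLinearGroup.toGL h ∈
      (commutator (SpecialLinearGroup (Fin 2) F)).map SpecialLinearGroup.toGL :=
    Subgroup.mem_map.mpr ⟨h, by rw [T5SL2Perfect.commutator_eq_top a ha ha2]; trivial, rfl⟩
  rw [map_commutator_eq] at hmap
  exact Subgroup.commutator_mono le_top le_top hmap

/-- The determinant of an element of `GL₂(F)` is non-zero. -/
lemma det_ne_zero (g : GL (Fin 2) F) : (g : Matrix (Fin 2) (Fin 2) F).det ≠ 0 := by
  intro h0
  apply (Matrix.GeneralLinearGroup.det g).ne_zero
  rw [Matrix.GeneralLinearGroup.val_det_apply]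
  exact h0

/-- `g² = (det g · 1) · h` with `det h = 1`, as elements of `GL₂(F)`. -/
theorem sq_eq_scalar_mul (g : GL (Fin 2) F) :
    ∃ h : SpecialLinearGroup (Fin 2) F,
      g * g = scalar (g : Matrix (Fin 2) (Fin 2) F).det (det_ne_zero g) * SpecialLinearGroup.toGL h := by
  set d : F := (g : Matrix (Fin 2) (Fin 2) F).det with hd
  have hd0 : d ≠ 0 := det_ne_zero g
  refine ⟨⟨(((scalar d hd0)⁻¹ * g * g : GL (Fin 2) F) : Matrix (Fin 2) (Fin 2) F), ?_⟩, ?_⟩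
  · rw [Units.val_mul, Units.val_mul, det_mul, det_mul, coe_scalar_inv, det_smul, det_one,
      Fintype.card_fin, mul_one, ← hd, inv_pow, pow_two, mul_assoc, inv_mul_cancel₀ (mul_ne_zero hd0 hd0)]
  · apply Units.ext
    show ((g * g : GL (Fin 2) F) : Matrix (Fin 2) (Fin 2) F) =
      (scalar d hd0 : Matrix (Fin 2) (Fin 2) F) *
        (((scalar d hd0)⁻¹ * g * g : GL (Fin 2) F) : Matrix (Fin 2) (Fin 2) F)
    rw [← Units.val_mul, ← mul_assoc, ← mul_assoc, mul_inv_cancel, one_mul]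

end algebra

section general

variable {F : Type*} [Field F] [TopologicalSpace F] [IsTopologicalRing F] [T2Space F]
  [LocallyCompactSpace F]

/-- `M₂(F)ᵐᵒᵖ` is locally compact. -/
instance instLocallyCompactSpaceMop : LocallyCompactSpace (Matrix (Fin 2) (Fin 2) F)ᵐᵒᵖ :=
  MulOpposite.opHomeomorph.symm.isClosedEmbedding.locallyCompactSpace

/-- `GL₂(F)` is locally compact (closed in `M₂(F) × M₂(F)ᵐᵒᵖ` through `Units.embedProduct`). -/
instance instLocallyCompactSpaceGL : LocallyCompactSpace (GL (Fin 2) F) :=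
  Units.isClosedEmbedding_embedProduct.locallyCompactSpace

/-- **The modular character of `GL₂(F)` is trivial** (`F` locally compact Hausdorff with `a ≠ 0`,
`a² ≠ 1`): `Δ(g)² = Δ(g²) = Δ(det g · 1) Δ(h) = 1`. -/
theorem modularCharacterFun_eq_one (a : F) (ha : a ≠ 0) (ha2 : a ^ 2 ≠ 1) (g : GL (Fin 2) F) :
    modularCharacterFun g = 1 := by
  obtain ⟨h, hg⟩ := sq_eq_scalar_mul g
  have hsq : modularCharacterFun g ^ 2 = 1 := by
    rw [pow_two, ← modularCharacterFun_map_mul, hg, modularCharacterFun_map_mul,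
      T5U11Unimodular.modularCharacterFun_eq_one_of_mem_center (scalar_mem_center _ _),
      T5UnimodularPerfect.modularCharacterFun_eq_one_of_mem_commutator (toGL_mem_commutator a ha ha2 h),
      one_mul]
  exact (sq_eq_sq₀ (zero_le : (0 : ℝ≥0) ≤ modularCharacterFun g) zero_le_one).mp
    (by rw [hsq, one_pow])

/-- `modularCharacter = 1` on `GL₂(F)`. -/
theorem modularCharacter_eq_one (a : F) (ha : a ≠ 0) (ha2 : a ^ 2 ≠ 1) :
    (modularCharacter : GL (Fin 2) F →* ℝ≥0) = 1 :=
  MonoidHom.ext fun g => modularCharacterFun_eq_one a ha ha2 g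

/-- **`GL₂(F)` is unimodular**: every inner regular left Haar measure is right-invariant. -/
theorem isMulRightInvariant (a : F) (ha : a ≠ 0) (ha2 : a ^ 2 ≠ 1) [MeasurableSpace (GL (Fin 2) F)]
    [BorelSpace (GL (Fin 2) F)] (μ : Measure (GL (Fin 2) F)) [IsHaarMeasure μ] [InnerRegular μ] :
    IsMulRightInvariant μ := by
  refine ⟨fun g => ?_⟩
  rw [map_right_mul_eq_modularCharacterFun_smul μ g, modularCharacterFun_eq_one a ha ha2, one_smul]

/-- Every inner regular left Haar measure on `GL₂(F)` is inversion-invariant. -/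
theorem isInvInvariant (a : F) (ha : a ≠ 0) (ha2 : a ^ 2 ≠ 1) [MeasurableSpace (GL (Fin 2) F)]
    [BorelSpace (GL (Fin 2) F)] (μ : Measure (GL (Fin 2) F)) [IsHaarMeasure μ] [InnerRegular μ] :
    IsInvInvariant μ :=
  haveI := isMulRightInvariant a ha ha2 μ
  T5UnimodularPerfect.isInvInvariant_of_isMulRightInvariant μ

end general

section charZero

variable {F : Type*} [Field F] [TopologicalSpace F] [IsTopologicalRing F] [T2Space F]
  [LocallyCompactSpace F] [CharZero F]

/-- The modular character of `GL₂(F)` is trivial for every locally compact Hausdorff field of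
characteristic zero. -/
theorem modularCharacterFun_eq_one_of_charZero (g : GL (Fin 2) F) : modularCharacterFun g = 1 :=
  modularCharacterFun_eq_one (2 : F) two_ne_zero (by norm_num) g

/-- Every inner regular left Haar measure on `GL₂(F)` is right-invariant (characteristic zero). -/
theorem isMulRightInvariant_of_charZero [MeasurableSpace (GL (Fin 2) F)] [BorelSpace (GL (Fin 2) F)]
    (μ : Measure (GL (Fin 2) F)) [IsHaarMeasure μ] [InnerRegular μ] : IsMulRightInvariant μ :=
  isMulRightInvariant (2 : F) two_ne_zero (by norm_num) μ

end charZero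

/-- The modular character of `GL₂(ℝ)` is trivial. -/
theorem modularCharacterFun_eq_one_real (g : GL (Fin 2) ℝ) : modularCharacterFun g = 1 :=
  modularCharacterFun_eq_one_of_charZero g

/-- The modular character of `GL₂(ℂ)` is trivial. -/
theorem modularCharacterFun_eq_one_complex (g : GL (Fin 2) ℂ) : modularCharacterFun g = 1 :=
  modularCharacterFun_eq_one_of_charZero g

/-- **`GL₂(ℚ_p)` has trivial modular character** — «a reductive `p`-adic group is unimodular» for
the reductive group `GL₂`. -/
theorem modularCharacterFun_eq_one_padic (p : ℕ) [Fact p.Prime] (g : GL (Fin 2) ℚ_[p]) :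
    modularCharacterFun g = 1 :=
  modularCharacterFun_eq_one_of_charZero g

/-- Every inner regular left Haar measure on `GL₂(ℚ_p)` is right-invariant. -/
theorem isMulRightInvariant_padic (p : ℕ) [Fact p.Prime] [MeasurableSpace (GL (Fin 2) ℚ_[p])]
    [BorelSpace (GL (Fin 2) ℚ_[p])] (μ : Measure (GL (Fin 2) ℚ_[p])) [IsHaarMeasure μ]
    [InnerRegular μ] : IsMulRightInvariant μ :=
  isMulRightInvariant_of_charZero μ

end Summit.Ventures.HodgeRepro2.T5GL2Unimodular
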